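import Summits.ABC.IUTFork.Conditional.FreyLegendreP6EngineList
import HarnessLib

/-!
# (P6) LIST ENGINE, EULER-CRITERION FORM — root-freeness of the Frobenius certificate by ONE modular power per level

PROOF-ONLY file (D-0012; 0 definitions, 0 `Prop` facts, no instance, no notation) of the abc-iut cell (seat abc-iut-w6-d102, gen 8;
row «C:P6-N3-BANDS-INH»). The list engine `FreyP6Engine.condP6_ratPoint_of_certificate_list` (p484675) takes the root-freeness of the
Frobenius certificate `X² − a_p X + p` modulo every listed level `l` in the `ℕ`-form `∀ l ∈ L, ∀ t < l, ¬ l ∣ t² − a_p t + p` — ONE kernel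
`decide`, but of cost `Σ_{l ∈ L} l` (calibration 2026-08-27, HOME/staging/w6/w6-d102/g7/RECIPE-band-nonvacuity.md: `Σ l ≈ 7·10⁵` times out).
Here the same engine is fed through EULER'S CRITERION instead: for an odd prime `l`, if `d = a_p² − 4p` satisfies
`d^((l−1)/2) ≡ −1 (mod l)` then `d` is a non-zero NON-square in `𝔽_l`, hence `4(t² − a_p t + p) = (2t − a_p)² − d ≠ 0` for every
`t`, i.e. the certificate polynomial is root-free mod `l`. The hypothesis — with `m = 4p − a_p²` (a positive integer by the Hasse bound) — `∀ l ∈ L, (m % l)^(l / 2) % l = (l − 1 if l ≡ 1 mod 4, else 1)`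
is again ONE kernel `decide`, in pure `ℕ` arithmetic of cost `O(log l)` big-integer operations per level (the kernel's GMP `Nat.pow` / `Nat.mod`),
so whole refuted bands of hundreds of levels become one list theorem.
* `FreyP6Engine.noroot_zmod_of_euler` — the Euler-criterion root-freeness lemma (`ZMod.euler_criterion`, `Even.neg_one_pow` / `Odd.neg_one_pow`,
  `Ring.neg_one_ne_one_of_char_ne_two`).
* `FreyP6Engine.prime_of_trialDivision` / `forall_prime_and_of_trialDivision` — primality of every listed level by trial division below a
  bound `B` with `l < B²` (kernel-cheap replacement for the default `Nat.minFac` instance inside list side conditions).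
* `FreyP6Engine.condP6_ratPoint_of_certificate_list_euler` — the list engine with the Euler-form hypothesis; every other input VERBATIM as in
  `condP6_ratPoint_of_certificate_list` (one multiplicative prime `q`: `q ∤ c₄`, `Δ = q^k·D`, `q ∤ D`; one good prime `p` with `a_p`; side
  conditions `l.Prime ∧ l ∤ 46080 ∧ q ∤ l ∧ l ∤ k ∧ p ≠ l`).
HONEST SCOPE: classical arithmetic (Euler's criterion in `𝔽_l`, Mazur's Frobenius certificate, a Tate transvection) — an efficiency variant of an
existing kernel engine, nothing new is claimed about any datum; nothing about [IUTchIII] Cor. 3.12; no side taken on any author; typed ≠ proved;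
no abc claim.
[cite: Mochizuki2012, IUTchIV Cor. 2.2 (ii) (P6) p.46] [cite: Mazur1978, §6 Prop. 6.3 (1) (p. 153)] [claim: Mochizuki2012, status: disputed]
-/

noncomputable section

open scoped Classical
open WeierstrassCurve

namespace Summit.ABC.IUTFork.Conditional

namespace FreyP6Engine

open Literature.NumberTheory.EllipticCurves Literature.NumberTheory.DiophantineGeometry.GenEll
open Literature.NumberTheory.DiophantineGeometry Literature.IUT.LogVolume

/-- **Primality by bounded trial division** (kernel-cheap form): `2 ≤ l`, `l < B²` and no `2 ≤ m < B` divides `l` ⇒ `l` is prime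
(`Nat.prime_def_le_sqrt`, `Nat.sqrt_lt`). Unlike the default `Nat.decidablePrime` instance (well-founded `Nat.minFac`), this shape is decided by
the kernel in `B` cheap steps per level. [folklore] -/
theorem prime_of_trialDivision {B l : ℕ} (h2 : 2 ≤ l) (hB : l < B * B) (h : ∀ m < B, 2 ≤ m → ¬ m ∣ l) :
    l.Prime := by
  rw [Nat.prime_def_le_sqrt]
  refine ⟨h2, fun m hm2 hml => h m ?_ hm2⟩
  have : Nat.sqrt l < B := Nat.sqrt_lt.mpr hB
  omega

/-- **List side conditions with primality by trial division**: from ONE kernel `decide` of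
`∀ l ∈ L, (2 ≤ l ∧ l < B·B ∧ ∀ m < B, 2 ≤ m → m ∤ l) ∧ R l` get `∀ l ∈ L, l.Prime ∧ R l` — the shape of the `hside` hypotheses of
`condP6_ratPoint_of_certificate_list[_euler]` and of `FreyAdm.nonempty_thetaVolumeDatumAt_triple_list`, for bands of levels beyond the reach
of the default primality instance in the kernel. [folklore] -/
theorem forall_prime_and_of_trialDivision (B : ℕ) (R : ℕ → Prop) (L : List ℕ)
    (h : ∀ l ∈ L, (2 ≤ l ∧ l < B * B ∧ ∀ m < B, 2 ≤ m → ¬ m ∣ l) ∧ R l) : ∀ l ∈ L, l.Prime ∧ R l :=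
  fun l hl => ⟨prime_of_trialDivision (h l hl).1.1 (h l hl).1.2.1 (h l hl).1.2.2, (h l hl).2⟩

/-- **Euler-criterion root-freeness, pure-`ℕ` certificate.** Let `l` be a prime, `l ≠ 2`, `a : ℤ`, `p m : ℕ` with `m = 4p − a²`
(for a Frobenius trace `|a| < 2√p`, so `m > 0`). If `(m % l)^(l / 2) % l` equals `l − 1` when `l ≡ 1 (mod 4)` and `1` otherwise — i.e.
`(a² − 4p)^((l−1)/2) = (−1)^((l−1)/2)·m^((l−1)/2) ≡ −1 (mod l)`: the discriminant `a² − 4p` is a non-zero quadratic NON-residue — then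
`X² − aX + p` has no root in `ZMod l`: a root `t` would give `(2t − a)² = a² − 4p`, a square, contradicting Euler's criterion
(`ZMod.euler_criterion`). The hypothesis is ONE modular power per level, in `ℕ` (kernel GMP arithmetic). [folklore] -/
theorem noroot_zmod_of_euler (l : ℕ) (hl : l.Prime) (hl2 : l ≠ 2) (a : ℤ) (p m : ℕ) (hm : (m : ℤ) = 4 * p - a ^ 2)
    (h : (m % l) ^ (l / 2) % l = if l % 4 = 1 then l - 1 else 1) :
    ∀ t : ZMod l, t ^ 2 - (a : ZMod l) * t + (p : ZMod l) ≠ 0 := by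
  haveI : Fact l.Prime := ⟨hl⟩
  have hl1 : 1 ≤ l := hl.one_lt.le
  have hodd : l % 2 = 1 := hl.eq_two_or_odd.resolve_left hl2
  -- the hypothesis in `ZMod l`: `(-(m : ZMod l)) ^ (l / 2) = -1`
  have hE : (-(m : ZMod l)) ^ (l / 2) = -1 := by
    rw [neg_pow]
    rcases Nat.odd_mod_four_iff.mp hodd with h1 | h3
    · rw [h1, if_pos rfl] at h
      have h' : (((m % l) ^ (l / 2) % l : ℕ) : ZMod l) = ((l - 1 : ℕ) : ZMod l) := by rw [h]
      rw [ZMod.natCast_mod, Nat.cast_pow, ZMod.natCast_mod, Nat.cast_sub hl1, Nat.cast_one, ZMod.natCast_self, zero_sub] at h'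
      have hev : Even (l / 2) := ⟨l / 4, by omega⟩
      rw [hev.neg_one_pow, one_mul, h']
    · rw [h3, if_neg (by decide)] at h
      have h' : (((m % l) ^ (l / 2) % l : ℕ) : ZMod l) = ((1 : ℕ) : ZMod l) := by rw [h]
      rw [ZMod.natCast_mod, Nat.cast_pow, ZMod.natCast_mod, Nat.cast_one] at h'
      have hod : Odd (l / 2) := ⟨l / 4, by omega⟩
      rw [hod.neg_one_pow, h', mul_one]
  intro t ht
  -- `(2t − a)² = a² − 4p = −m`
  have hmz : (m : ZMod l) = 4 * (p : ZMod l) - (a : ZMod l) ^ 2 := by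
    have := congrArg (fun z : ℤ => (z : ZMod l)) hm
    push_cast at this
    exact this
  have hsq : -(m : ZMod l) = (2 * t - (a : ZMod l)) ^ 2 := by
    rw [hmz]; linear_combination (-4 : ZMod l) * ht
  by_cases hd : (-(m : ZMod l)) = 0
  · -- `0 ^ (l/2) = 0 ≠ -1`
    rw [hd, zero_pow (Nat.div_pos hl.two_le two_pos).ne'] at hE
    exact (neg_ne_zero.mpr (one_ne_zero : (1 : ZMod l) ≠ 0)) hE.symm
  · have hsquare : IsSquare (-(m : ZMod l)) := ⟨2 * t - (a : ZMod l), by rw [hsq, sq]⟩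
    have h1 : (-(m : ZMod l)) ^ (l / 2) = 1 := (ZMod.euler_criterion l hd).mp hsquare
    rw [h1] at hE
    have hchar : ringChar (ZMod l) ≠ 2 := by rw [ZMod.ringChar_zmod_n]; exact hl2
    exact Ring.neg_one_ne_one_of_char_ne_two hchar hE.symm

/-- **(P6) ENGINE, LIST FORM, EULER-CRITERION CERTIFICATE.** Same as `condP6_ratPoint_of_certificate_list` (λ = a/c, `E₁ = [0, −(c²+ac), 0, ac³, 0]`,
ONE multiplicative prime `q` with `q ∤ c₄(E₁)`, `Δ(E₁) = q^k·D`, `q ∤ D`, ONE good prime `p` with `a_p(E₁) = ap`, side conditions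
`l.Prime ∧ l ∤ 46080 ∧ q ∤ l ∧ l ∤ k ∧ p ≠ l` for every `l ∈ L`), but the root-freeness of `X² − ap·X + p` mod each `l ∈ L` is supplied in the
pure-`ℕ` EULER form: `m = 4p − ap²` and `(m % l)^(l / 2) % l = (l ≡ 1 mod 4 ? l − 1 : 1)` — ONE kernel `decide` of logarithmic cost per level
(`noroot_zmod_of_euler`). THEN `Cor22.CondP6 (ratPoint λ) l` for every `l ∈ L`.
[cite: Mochizuki2012, IUTchIV Cor. 2.2 (ii) (P6) p.46] [cite: Mazur1978, §6 Prop. 6.3 (1) (p. 153)] -/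
theorem condP6_ratPoint_of_certificate_list_euler (a c : ℕ) (ha : a ≠ 0) (hc : c ≠ 0) (hac : a ≠ c)
    (q : ℕ) (hq : q.Prime)
    (hc4 : ¬ (q : ℤ) ∣ ((⟨0, -(((c : ℕ) : ℤ) ^ 2 + (a : ℕ) * (c : ℕ)), 0, ((a : ℕ) : ℤ) * ((c : ℕ) : ℤ) ^ 3, 0⟩ : WeierstrassCurve ℤ)).c₄)
    (k : ℕ) (hk0 : 0 < k) (D : ℤ)
    (hΔ : ((⟨0, -(((c : ℕ) : ℤ) ^ 2 + (a : ℕ) * (c : ℕ)), 0, ((a : ℕ) : ℤ) * ((c : ℕ) : ℤ) ^ 3, 0⟩ : WeierstrassCurve ℤ)).Δ = q ^ k * D)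
    (hD : ¬ (q : ℤ) ∣ D)
    (p : ℕ) (hp : p.Prime)
    (hpΔ : ¬ (p : ℤ) ∣ ((⟨0, -(((c : ℕ) : ℤ) ^ 2 + (a : ℕ) * (c : ℕ)), 0, ((a : ℕ) : ℤ) * ((c : ℕ) : ℤ) ^ 3, 0⟩ : WeierstrassCurve ℤ)).Δ)
    (ap : ℤ) (hap : Literature.NumberTheory.Automorphic.frobeniusTrace
        (⟨0, -(((c : ℕ) : ℤ) ^ 2 + (a : ℕ) * (c : ℕ)), 0, ((a : ℕ) : ℤ) * ((c : ℕ) : ℤ) ^ 3, 0⟩ : WeierstrassCurve ℤ) p = ap)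
    (m : ℕ) (hm : (m : ℤ) = 4 * p - ap ^ 2)
    (L : List ℕ) (hside : ∀ l ∈ L, l.Prime ∧ ¬ l ∣ 46080 ∧ ¬ q ∣ l ∧ ¬ l ∣ k ∧ p ≠ l)
    (heu : ∀ l ∈ L, (m % l) ^ (l / 2) % l = if l % 4 = 1 then l - 1 else 1) :
    ∀ l ∈ L, Cor22.CondP6 (ratPoint (((a : ℕ) : ℚ) / (c : ℕ))) l := by
  intro l hl
  obtain ⟨hlp, h46080, hql, hlk, hpl⟩ := hside l hl
  have hl2 : l ≠ 2 := by rintro rfl; exact h46080 (by norm_num)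
  haveI : Fact l.Prime := ⟨hlp⟩
  haveI : Fact p.Prime := ⟨hp⟩
  refine condP6_ratPoint_of_certificate a c ha hc hac l h46080 p hpl hpΔ ?_ q hq hql hc4 k hk0 hlk D hΔ hD
  rw [hap]
  exact noroot_zmod_of_euler l hlp hl2 ap p m hm (heu l hl)

end FreyP6Engine

end Summit.ABC.IUTFork.Conditional

end
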